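import Summits.PneNP.PneNP.Theses.BruckRyserSos

/-!
# Route BruckRyserSos — the assembly item

`Assembly := NoPolyBoundedProofSystem → PneNP` (stmt-PneNP-16765): the route's single deciding
hypothesis X (no polynomially bounded Cook–Reckhow proof system for TAUT, i.e. NP ≠ coNP,
stmt-PneNP-0097) implies the summit statement. This is literally the type of the route's certified
deciding theorem `closes`, so the proof is `closes` itself.
-/

set_option linter.dupNamespace false -- `Summit.PneNP.PneNP.…`: summit = sub-problem name (D-0017 single-conjunct layout)

namespace Summit.PneNP.PneNP.Theorems

/-- The assembly item of route BruckRyserSos (stmt-PneNP-16765): X ⇒ P ≠ NP, by the route's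
deciding theorem `closes` (Cook–Reckhow: P = NP ⇒ coNP = NP ⇒ TAUT ∈ NP ⇒ TAUT has a polynomially
bounded proof system). [CookReckhow1979, Prop. 1.1] -/
theorem bruckRyserSos_assembly_proof : Summit.PneNP.PneNP.Theses.BruckRyserSos.Assembly := by
  unfold Summit.PneNP.PneNP.Theses.BruckRyserSos.Assembly
  exact fun hX => Summit.PneNP.PneNP.Theses.BruckRyserSos.closes hX

end Summit.PneNP.PneNP.Theorems
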